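import Summits.BirchSwinnertonDyer.BirchSwinnertonDyer.Theorems.ByReductionTypeAtTwoMultTowerSplitExactOddCyclotomic
import Summits.BirchSwinnertonDyer.BirchSwinnertonDyer.Theorems.ByReductionTypeAtTwoMultTowerSplitExactTransfer
import Summits.BirchSwinnertonDyer.BirchSwinnertonDyer.Theorems.ByReductionTypeAtTwoMultTowerNS2TowerCosets
import Summits.BirchSwinnertonDyer.BirchSwinnertonDyer.Theorems.ByReductionTypeAtTwoGoodOrdTowerCoinvCocycle
import Mathlib.RingTheory.Polynomial.Cyclotomic.Eval
import HarnessLib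

/-!
# Route `ByReductionTypeAtTwo`, crux `MultUpperHalfAtTwo` (item stmt-BirchSwinnertonDyer-19922), TOWER road, SPLIT rows:
# the EXACT order of the local tower kernel at a split multiplicative prime, part 6 (ODD `p`) — `N_{F_m/ℚ_v}(η_m) = p`:
# the prime `p` is a norm from every local layer `F_m` of the cyclotomic `ℤ_p`-tower

HONEST FRAMING (cell `bsd-2adic`, run/shared/lean/pub/bsd-2adic/, seat `bsd-2adic-tower-1` GEN 27, HUMAN RULINGS
D-0036 / D-0054 / D-0074): TOOL theorems only (no definition, no named fact, no `sorry`); closes nothing by itself;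
nothing booked; BSD is not proved by any of this. Third ODD-`p` module towards the `∀ p` named fact
`hSP = Greenberg1999.sec3_natCard_localTowerKerPrimary_splitMultiplicative_rat`. The odd-`p` norm group
`N(F_mˣ) = ⟨p⟩ · {w : w^{p−1} ≡ 1 (mod p^{m+1})}` needs `p ∈ N(F_mˣ)`: here it is, as the norm of part 5's cyclotomic
element `η_m = ∏_{t^{p−1} = 1} (1 − ζ^t) ∈ F_m` (`ζ` a primitive `p^{m+1}`-th root of unity in `K̄_v`):

* `prod_units_one_sub_pow_eq_prime` — `∏_{a ∈ (ℤ/p^{m+1})ˣ} (1 − ζ^a) = Φ_{p^{m+1}}(1) = p`;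
* `norm_eq_prime_of_coe_eq_cyclotomicUnit` — **`N_{F_m/ℚ_v}(η_m) = p`**: with `g₀ ∈ Γ_{ℚ_v}`, `κ(res g₀) = 1`, the
  powers `g₀^j` (`j < p^m`) represent `Γ/H_m` (`GoodOrdTower.exists_pow_inv_mul_mem_localSubgroup_layerSubgroup`),
  so `N(η_m) = ∏_j g₀^j η_m = ∏_j ∏_{t ∈ S} (1 − ζ^{c^j t})` (`c = χ̄(g₀)`, `S = {t : t^{p−1} = 1}`); the map `(j, t) ↦ c^j t` hits every unit of `ℤ/p^{m+1}` (LOCAL SURJECTIVITY of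
  the cyclotomic character, the tree's `adicCompletion_rat_exists_mem_absInertia_cyclotomicCharacter_eq`: `a = χ̄(σ)`,
  `σ = g₀^j h`, `h ∈ H_m`, `χ̄(h) ∈ S` by part 5) and `#S ≤ p − 1` (cyclicity of `(ℤ/p^{m+1})ˣ`), so it is a bijection
  onto the units and the double product is `Φ_{p^{m+1}}(1) = p`;
* `exists_norm_fixedField_layer_eq_prime` — **`p ∈ N(F_mˣ)`**.

References: L. Washington, *Introduction to Cyclotomic Fields*, Lemma 1.4 / Prop. 2.8 (`N(1 − ζ) = p`) and §13.1;
J. Neukirch, *Algebraic Number Theory*, Ch. IV §1, Ch. V §1 (1.1); J.-P. Serre, *Local Fields* IV §4 Prop. 17;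
cell memo NOTE-HNS2-KERNEL-GEN27.md (Stage D plan).
-/

set_option autoImplicit false
-- the Theorems namespace of this sub repeats the summit name by design (D-0017 nested layout: Summit.<S>.<Sub>)
set_option linter.dupNamespace false

noncomputable section

open scoped Classical IntermediateField

namespace Summit.BirchSwinnertonDyer.BirchSwinnertonDyer.Theorems.MultTowerSplitExact

open NumberField IsDedekindDomain Field PadicInt Literature.NumberTheory.EllipticCurves
  Literature.NumberTheory.GaloisRepresentations

variable {p : ℕ} [hp : Fact p.Prime] {κ : ZpExtension ℚ p}

/-! ### `∏_{a ∈ (ℤ/p^{m+1})ˣ} (1 − ζ^a) = p` -/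

/-- **`∏_{a ∈ (ℤ/p^{m+1})ˣ} (1 − ζ^a) = Φ_{p^{m+1}}(1) = p`** for a primitive `p^{m+1}`-th root of unity `ζ` of a domain:
the `ζ^a`, `a` a unit of `ℤ/p^{m+1}`, are exactly the primitive `p^{m+1}`-th roots of unity (Mathlib
`cyclotomic_eq_prod_X_sub_primitiveRoots`, `eval_one_cyclotomic_prime_pow`). [cite: Washington1997, Lemma 1.4] -/
theorem prod_units_one_sub_pow_eq_prime {L : Type*} [CommRing L] [IsDomain L] (m : ℕ) {ζ : L}
    (hζ : IsPrimitiveRoot ζ (p ^ (m + 1))) :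
    ∏ a : (ZMod (p ^ (m + 1)))ˣ, (1 - ζ ^ ((a : ZMod (p ^ (m + 1))).val)) = (p : L) := by
  haveI : NeZero (p ^ (m + 1)) := ⟨pow_ne_zero _ hp.out.ne_zero⟩
  have h0 : 0 < p ^ (m + 1) := pow_pos hp.out.pos _
  -- the image of `a ↦ ζ^a` on the units is the set of primitive roots
  have himage : (Finset.univ : Finset (ZMod (p ^ (m + 1)))ˣ).image
      (fun a : (ZMod (p ^ (m + 1)))ˣ ↦ ζ ^ ((a : ZMod (p ^ (m + 1))).val)) = primitiveRoots (p ^ (m + 1)) L := by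
    ext μ
    rw [Finset.mem_image, mem_primitiveRoots h0]
    constructor
    · rintro ⟨a, -, rfl⟩
      exact (hζ.pow_iff_coprime h0 _).mpr (ZMod.val_coe_unit_coprime a)
    · intro hμ
      obtain ⟨i, hi, rfl⟩ := hζ.eq_pow_of_pow_eq_one hμ.pow_eq_one
      have hcop : i.Coprime (p ^ (m + 1)) := (hζ.pow_iff_coprime h0 i).mp hμ
      refine ⟨ZMod.unitOfCoprime i hcop, Finset.mem_univ _, ?_⟩
      simp only [ZMod.coe_unitOfCoprime, ZMod.val_natCast, Nat.mod_eq_of_lt hi]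
  have hinj : Set.InjOn (fun a : (ZMod (p ^ (m + 1)))ˣ ↦ ζ ^ ((a : ZMod (p ^ (m + 1))).val))
      ↑(Finset.univ : Finset (ZMod (p ^ (m + 1)))ˣ) := by
    intro a _ b _ hab
    exact Units.ext (ZMod.val_injective _ (hζ.pow_inj (ZMod.val_lt _) (ZMod.val_lt _) hab))
  have heval := Polynomial.eval_one_cyclotomic_prime_pow (R := L) (p := p) m
  rw [Polynomial.cyclotomic_eq_prod_X_sub_primitiveRoots hζ, Polynomial.eval_prod] at heval
  simp only [Polynomial.eval_sub, Polynomial.eval_X, Polynomial.eval_C] at heval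
  rw [← himage, Finset.prod_image hinj] at heval
  exact heval

/-! ### `N_{F_m/ℚ_v}(η_m) = p` -/

/-- **`N_{F_m/ℚ_v}(η_m) = p`** (odd `p`, `v ∋ p`, `κ` the cyclotomic `ℤ_p`-extension): for `ζ ∈ K̄_v` a primitive
`p^{m+1}`-th root of unity and `f ∈ F_m = K̄_v^{H_m}` the cyclotomic element `η_m = ∏_{t ∈ S} (1 − ζ^t)`,
`S = {t ∈ (ℤ/p^{m+1})ˣ : t^{p−1} = 1}` (part 5), the norm of `f` to `ℚ_v` is `p`. With `κ(res g₀) = 1` the `g₀^j`,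
`j < p^m`, represent `Γ_{ℚ_v}/H_m`, so `N(f) = ∏_j g₀^j η_m = ∏_{(j,t)} (1 − ζ^{χ̄(g₀)^j t})`; `(j, t) ↦ χ̄(g₀)^j t` is onto
`(ℤ/p^{m+1})ˣ` (every unit is a local cyclotomic character `χ̄(σ)`, `σ = g₀^j h` with `h ∈ H_m`, `χ̄(h) ∈ S`) from a set of
size `p^m · #S ≤ p^m (p − 1)`, hence a bijection, and the product is `∏_a (1 − ζ^a) = p`.
[cite: Washington1997, §13.1 and Lemma 1.4] [cite: SerreLocalFields1979, Ch. IV §4 Prop. 17] -/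
theorem norm_eq_prime_of_coe_eq_cyclotomicUnit (hp2 : p ≠ 2) (hκ : κ.IsCyclotomic) (v : HeightOneSpectrum (𝓞 ℚ))
    (hv : ((p : ℕ) : 𝓞 ℚ) ∈ v.asIdeal) (m : ℕ) {ζ : AlgebraicClosure (v.adicCompletion ℚ)}
    (hζ : IsPrimitiveRoot ζ (p ^ (m + 1)))
    (f : IntermediateField.fixedField (localSubgroup (κ.layerSubgroup m) (v.adicCompletion ℚ)))
    (hf : (f : AlgebraicClosure (v.adicCompletion ℚ)) =
      ∏ t ∈ (Finset.univ.filter fun t : (ZMod (p ^ (m + 1)))ˣ ↦ t ^ (p - 1) = 1),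
        (1 - ζ ^ ((t : ZMod (p ^ (m + 1))).val))) :
    Algebra.norm (v.adicCompletion ℚ) f = (p : v.adicCompletion ℚ) := by
  haveI : NeZero (p ^ (m + 1)) := ⟨pow_ne_zero _ hp.out.ne_zero⟩
  have hζ1 : ζ ^ p ^ (m + 1) = 1 := hζ.pow_eq_one
  have hpK : ((p : ℕ) : v.adicCompletion ℚ) ≠ 0 := by
    rw [← map_natCast (algebraMap ℚ (v.adicCompletion ℚ))]
    exact (map_ne_zero_iff _ (algebraMap ℚ (v.adicCompletion ℚ)).injective).mpr (by exact_mod_cast hp.out.ne_zero)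
  haveI : NeZero ((p : ℕ) : v.adicCompletion ℚ) := ⟨hpK⟩
  set S : Finset (ZMod (p ^ (m + 1)))ˣ := Finset.univ.filter fun t : (ZMod (p ^ (m + 1)))ˣ ↦ t ^ (p - 1) = 1 with hS
  -- the cyclotomic character modulo `p^{m+1}`
  let χb : absoluteGaloisGroup (v.adicCompletion ℚ) →* (ZMod (p ^ (m + 1)))ˣ :=
    (Units.map (toZModPow (p := p) (m + 1)).toMonoidHom).comp
      (GaloisRep.cyclotomicCharacter (v.adicCompletion ℚ) p).toMonoidHom
  have hχb : ∀ σ : absoluteGaloisGroup (v.adicCompletion ℚ), ((χb σ : (ZMod (p ^ (m + 1)))ˣ) : ZMod (p ^ (m + 1))) =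
      toZModPow (m + 1) (((GaloisRep.cyclotomicCharacter (v.adicCompletion ℚ) p σ : ℤ_[p]ˣ)) : ℤ_[p]) := fun _ ↦ rfl
  -- (1) `χ̄(h) ∈ S` for `h ∈ H_m` (part 5)
  have hHS : ∀ h ∈ localSubgroup (κ.layerSubgroup m) (v.adicCompletion ℚ), χb h ∈ S := by
    intro h hh
    rw [hS, Finset.mem_filter]
    refine ⟨Finset.mem_univ _, Units.ext ?_⟩
    rw [Units.val_pow_eq_pow_val, hχb, ← map_pow, Units.val_one]
    exact toZModPow_pow_cyclotomicCharacter_of_mem_layer hp2 hκ v hh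
  -- (2) the action on the factors: `σ (1 − ζ^t) = 1 − ζ^{χ̄(σ) t}`
  have hpowmod : ∀ a b : ZMod (p ^ (m + 1)), (ζ ^ a.val) ^ b.val = ζ ^ (b * a).val := by
    intro a b
    rw [← pow_mul, ZMod.val_mul, mul_comm a.val, pow_eq_pow_mod (b.val * a.val) hζ1]
  have hfac : ∀ (σ : absoluteGaloisGroup (v.adicCompletion ℚ)) (t : (ZMod (p ^ (m + 1)))ˣ),
      σ • (1 - ζ ^ ((t : ZMod (p ^ (m + 1))).val)) =
        1 - ζ ^ (((χb σ * t : (ZMod (p ^ (m + 1)))ˣ) : ZMod (p ^ (m + 1))).val) := by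
    intro σ t
    have hσζ : σ • ζ = ζ ^ ((χb σ : (ZMod (p ^ (m + 1)))ˣ) : ZMod (p ^ (m + 1))).val :=
      GaloisRep.cyclotomicCharacter_spec (v.adicCompletion ℚ) p (k := m + 1) σ ζ hζ1
    rw [smul_sub, smul_one, smul_pow', hσζ, hpowmod, Units.val_mul, mul_comm]
  have horb : ∀ σ : absoluteGaloisGroup (v.adicCompletion ℚ),
      σ • (f : AlgebraicClosure (v.adicCompletion ℚ)) =
        ∏ t ∈ S, (1 - ζ ^ (((χb σ * t : (ZMod (p ^ (m + 1)))ˣ) : ZMod (p ^ (m + 1))).val)) := by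
    intro σ
    rw [hf, Finset.smul_prod']
    exact Finset.prod_congr rfl fun t _ ↦ hfac σ t
  -- (3) `g₀` with `κ(res g₀) = 1` and the cosets `g₀^j H_m`, `j < p^m`
  obtain ⟨g₀, hg₀'⟩ := MultTowerNS2.surjective_kappa_comp_resGal hκ v hv (Multiplicative.ofAdd (1 : ℤ_[p]))
  have hg₀ : ((κ (resGal (K := ℚ) (v.adicCompletion ℚ) g₀)).toAdd : ℤ_[p]) =
      (p : ℤ_[p]) ^ 0 * ((1 : ℤ_[p]ˣ) : ℤ_[p]) := by
    have h := congrArg Multiplicative.toAdd hg₀'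
    rw [toAdd_ofAdd] at h
    rw [pow_zero, Units.val_one, one_mul]
    exact h
  have hdec : ∀ σ : absoluteGaloisGroup (v.adicCompletion ℚ), ∃ j : ℕ, j < p ^ m ∧
      (g₀ ^ j)⁻¹ * σ ∈ localSubgroup (κ.layerSubgroup m) (v.adicCompletion ℚ) := by
    intro σ
    have hσ0 : σ ∈ localSubgroup (κ.layerSubgroup 0) (v.adicCompletion ℚ) := by
      rw [mem_localSubgroup_iff, ZpExtension.mem_layerSubgroup, pow_zero]; exact one_dvd _
    obtain ⟨j, hj, hjσ⟩ := GoodOrdTower.exists_pow_inv_mul_mem_localSubgroup_layerSubgroup (κ := κ) v 0 m hg₀ hσ0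
    rw [Nat.zero_add] at hjσ
    exact ⟨j, hj, hjσ⟩
  have hcov : ∀ σ : absoluteGaloisGroup (v.adicCompletion ℚ), ∃ j : Fin (p ^ m),
      σ⁻¹ * g₀ ^ (j : ℕ) ∈ localSubgroup (κ.layerSubgroup m) (v.adicCompletion ℚ) := by
    intro σ
    obtain ⟨j, hj, hjσ⟩ := hdec σ
    refine ⟨⟨j, hj⟩, ?_⟩
    have h := Subgroup.inv_mem _ hjσ
    rwa [mul_inv_rev, inv_inv] at h
  -- (4) `(j, t) ↦ χ̄(g₀)^j t` maps `[0, p^m) × S` ONTO the units of `ℤ/p^{m+1}`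
  have hv' : (Rat.HeightOneSpectrum.primesEquiv v : ℕ) = p := by
    have h1 : Rat.HeightOneSpectrum.natGenerator v ∣ p := by
      rw [Rat.HeightOneSpectrum.natGenerator_dvd_iff, Ideal.mem_map_of_equiv]
      exact ⟨p, hv, map_natCast _ p⟩
    exact (Nat.prime_dvd_prime_iff_eq (Rat.HeightOneSpectrum.prime_natGenerator v) hp.out).mp h1
  obtain ⟨Φ, hΦ⟩ : ∃ Φ : ℕ × (ZMod (p ^ (m + 1)))ˣ → (ZMod (p ^ (m + 1)))ˣ, ∀ x, Φ x = χb g₀ ^ x.1 * x.2 :=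
    ⟨fun x ↦ χb g₀ ^ x.1 * x.2, fun _ ↦ rfl⟩
  have hsurj : ∀ a : (ZMod (p ^ (m + 1)))ˣ, ∃ x ∈ Finset.range (p ^ m) ×ˢ S, Φ x = a := by
    intro a
    -- a `p`-adic unit lifting `a`
    obtain ⟨u, hu⟩ : ∃ u : ℤ_[p]ˣ, toZModPow (m + 1) (u : ℤ_[p]) = a := by
      set n : ℕ := (a : ZMod (p ^ (m + 1))).val with hn
      have hcop : n.Coprime p :=
        (ZMod.val_coe_unit_coprime a).coprime_dvd_right (dvd_pow_self p (Nat.succ_ne_zero m))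
      have hpn : ¬ p ∣ n := (Nat.Prime.coprime_iff_not_dvd hp.out).mp hcop.symm
      have hun : IsUnit ((n : ℤ) : ℤ_[p]) := by
        rw [PadicInt.isUnit_iff]
        refine le_antisymm (PadicInt.norm_le_one _) ?_
        by_contra hlt
        rw [not_le, PadicInt.norm_int_lt_one_iff_dvd] at hlt
        exact hpn (by exact_mod_cast hlt)
      refine ⟨hun.unit, ?_⟩
      rw [IsUnit.unit_spec, map_intCast, Int.cast_natCast, hn, ZMod.natCast_zmod_val]
    obtain ⟨σ, -, hσ⟩ := adicCompletion_rat_exists_mem_absInertia_cyclotomicCharacter_eq (p := p) (v := v) hv' u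
    have hχσ : χb σ = a := Units.ext (by rw [hχb, hσ, hu])
    obtain ⟨j, hj, hjσ⟩ := hdec σ
    refine ⟨(j, χb ((g₀ ^ j)⁻¹ * σ)), Finset.mem_product.mpr ⟨Finset.mem_range.mpr hj, hHS _ hjσ⟩, ?_⟩
    rw [hΦ, ← map_pow, ← map_mul, mul_inv_cancel_left, hχσ]
  haveI hcyc : IsCyclic (ZMod (p ^ (m + 1)))ˣ := ZMod.isCyclic_units_of_prime_pow p hp.out hp2 (m + 1)
  have hScard : S.card ≤ p - 1 := by
    rw [hS]
    exact IsCyclic.card_pow_eq_one_le (by have := hp.out.two_le; omega)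
  have hGcard : Fintype.card (ZMod (p ^ (m + 1)))ˣ = (p - 1) * p ^ m := by
    rw [ZMod.card_units_eq_totient, Nat.totient_prime_pow hp.out (by omega), Nat.add_sub_cancel, mul_comm]
  have himage : (Finset.range (p ^ m) ×ˢ S).image Φ = Finset.univ :=
    Finset.eq_univ_of_forall fun a ↦ Finset.mem_image.mpr (hsurj a)
  have hcardD : ((Finset.range (p ^ m) ×ˢ S).image Φ).card = (Finset.range (p ^ m) ×ˢ S).card := by
    refine le_antisymm Finset.card_image_le ?_
    rw [himage, Finset.card_univ, hGcard, Finset.card_product, Finset.card_range, mul_comm]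
    exact Nat.mul_le_mul_right _ hScard
  have hinj : Set.InjOn Φ ↑(Finset.range (p ^ m) ×ˢ S) := Finset.card_image_iff.mp hcardD
  -- (5) the orbit product over the representatives is `∏_a (1 − ζ^a) = p`
  have hprod : (∏ j : Fin (p ^ m), (g₀ ^ (j : ℕ)) • (f : AlgebraicClosure (v.adicCompletion ℚ))) =
      ∏ a : (ZMod (p ^ (m + 1)))ˣ, (1 - ζ ^ ((a : ZMod (p ^ (m + 1))).val)) := by
    rw [Fin.prod_univ_eq_prod_range (fun j ↦ (g₀ ^ j) • (f : AlgebraicClosure (v.adicCompletion ℚ))) (p ^ m)]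
    have h1 : ∀ j ∈ Finset.range (p ^ m), (g₀ ^ j) • (f : AlgebraicClosure (v.adicCompletion ℚ)) =
        ∏ t ∈ S, (1 - ζ ^ ((Φ (j, t) : ZMod (p ^ (m + 1))).val)) := by
      intro j _
      rw [horb (g₀ ^ j), map_pow]
      refine Finset.prod_congr rfl fun t _ ↦ ?_
      rw [hΦ]
    rw [Finset.prod_congr rfl h1,
      ← Finset.prod_product (Finset.range (p ^ m)) S
        (fun x ↦ (1 - ζ ^ ((Φ x : ZMod (p ^ (m + 1))).val))),
      ← Finset.prod_image (f := fun a : (ZMod (p ^ (m + 1)))ˣ ↦ (1 - ζ ^ ((a : ZMod (p ^ (m + 1))).val))) hinj,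
      himage]
  -- (6) the norm as the orbit product (BRICK `algebraMap_norm_eq_prod_smul`)
  haveI := MultTowerNS2.finiteDimensional_fixedField_localSubgroup_layerSubgroup (κ := κ) v m
  have hopen := MultTowerNS2.isOpen_localSubgroup (κ.layerSubgroup m) (κ.isOpen_layerSubgroup m) (v.adicCompletion ℚ)
  haveI := isGalois_fixedField_of_isOpen_of_normal v (localSubgroup (κ.layerSubgroup m) (v.adicCompletion ℚ)) hopen
    (by rw [localSubgroup_eq_comap]; exact Subgroup.Normal.comap inferInstance _)
  have hrank := MultTowerNS2.finrank_fixedField_localSubgroup_layerSubgroup hκ v hv m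
  have hcard : Fintype.card (Fin (p ^ m)) = Module.finrank (v.adicCompletion ℚ)
      (IntermediateField.fixedField (localSubgroup (κ.layerSubgroup m) (v.adicCompletion ℚ))) := by
    rw [hrank, Fintype.card_fin]
  -- (`CharZero ℚ_v` only now: it changes the preferred `Algebra ℚ ℚ_v` instance, see BRICK 14)
  haveI : CharZero (v.adicCompletion ℚ) :=
    charZero_of_injective_algebraMap (algebraMap ℚ (v.adicCompletion ℚ)).injective
  have hfix := fixingSubgroup_fixedField_of_isOpen _ hopen
  have hH := fun σ ↦ SetLike.ext_iff.mp hfix σ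
  have hnorm := MultTowerNS2.algebraMap_norm_eq_prod_smul v _ hH (fun j : Fin (p ^ m) ↦ g₀ ^ (j : ℕ)) hcov hcard f
  rw [hprod, prod_units_one_sub_pow_eq_prime m hζ, ← map_natCast (algebraMap (v.adicCompletion ℚ)
    (AlgebraicClosure (v.adicCompletion ℚ)))] at hnorm
  exact (algebraMap (v.adicCompletion ℚ) (AlgebraicClosure (v.adicCompletion ℚ))).injective hnorm

/-- **`p ∈ N(F_mˣ)`** (odd `p`, `v ∋ p`): some element of the `m`-th local layer `F_m` of the cyclotomic `ℤ_p`-tower has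
norm `p` to `ℚ_v` — the cyclotomic element `η_m` of part 5. [cite: Washington1997, §13.1 and Lemma 1.4] -/
theorem exists_norm_fixedField_layer_eq_prime (hp2 : p ≠ 2) (hκ : κ.IsCyclotomic) (v : HeightOneSpectrum (𝓞 ℚ))
    (hv : ((p : ℕ) : 𝓞 ℚ) ∈ v.asIdeal) (m : ℕ) :
    ∃ f : IntermediateField.fixedField (localSubgroup (κ.layerSubgroup m) (v.adicCompletion ℚ)),
      Algebra.norm (v.adicCompletion ℚ) f = (p : v.adicCompletion ℚ) := by
  have hpK : ((p : ℕ) : v.adicCompletion ℚ) ≠ 0 := by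
    rw [← map_natCast (algebraMap ℚ (v.adicCompletion ℚ))]
    exact (map_ne_zero_iff _ (algebraMap ℚ (v.adicCompletion ℚ)).injective).mpr (by exact_mod_cast hp.out.ne_zero)
  haveI : NeZero ((p ^ (m + 1) : ℕ) : AlgebraicClosure (v.adicCompletion ℚ)) := ⟨by
    rw [Nat.cast_pow, ← map_natCast (algebraMap (v.adicCompletion ℚ) (AlgebraicClosure (v.adicCompletion ℚ)))]
    exact pow_ne_zero _ ((map_ne_zero_iff _ (algebraMap _ _).injective).mpr hpK)⟩
  obtain ⟨ζ, hζ⟩ := HasEnoughRootsOfUnity.exists_primitiveRoot (AlgebraicClosure (v.adicCompletion ℚ)) (p ^ (m + 1))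
  exact ⟨⟨_, prod_one_sub_pow_mem_fixedField_layer hp2 hκ v m hζ.pow_eq_one⟩,
    norm_eq_prime_of_coe_eq_cyclotomicUnit hp2 hκ v hv m hζ _ rfl⟩

end Summit.BirchSwinnertonDyer.BirchSwinnertonDyer.Theorems.MultTowerSplitExact

end
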